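import Literature.Probability.LatticeModels.NishimoriPathIdentity
import Literature.Probability.LatticeModels.VillainMonotonicityProofs
import HarnessLib

/-!
# The Villain model with quenched bond phases on a finite bond system (Nishimori set-up)

C. Garban, T. Spencer, *Continuous symmetry breaking along the Nishimori line*, J. Math. Phys.
**63** (2022) 093302 = arXiv:2109.01617, prove long-range order of the classical XY model in
`d ≥ 3` with free boundary condition by disordering the bond phases along the Nishimori line
(Definitions 1–2, Lemma 2.1, Theorem 1.3), and record in Remark 10 that "the proof extends
verbatim to the Villain interaction".  The tree holds the complete formal proof of the XY case
(`DisorderedXYModel`, `NishimoriGaugeIdentity`, `NishimoriPathIdentity`, `NishimoriPathEstimator`,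
`MMPInequality`, `GarbanSpencerXYLongRangeOrderProofs`).  This file is the vocabulary of the
VILLAIN case (the substitution `e^{β cos θ} ⟹ v_K(θ) = ∑_{m ∈ ℤ} e^{−(K/2)(θ + 2πm)²}` of
Aizenman–Harel–Peled–Shapiro 2021 §3.1, `villainKernel`), on an arbitrary finite bond system
`G : BondSystem V ι` (vertices `V`, oriented bonds `a : src a → tgt a`), spins on the torus
`U(1)^V` with its Haar probability measure `torusHaar V`:

* `BondSystem.villainWeight G K u θ = ∏_a v_K(arg Y_a(θ,u))`, `Y_a = u_a θ̄_{src a} θ_{tgt a}`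
  (the tree's `BondSystem.bondVar`), the Villain Gibbs weight with quenched bond phases `u_a`
  (pure model: `u ≡ 1`), its partition function `villainPartitionFn`, and the real / complex
  Gibbs expectations `villainExpect`, `villainCExpect`;
* the **Nishimori disorder of the Villain model**: independent phases with the single-bond law
  `v_K(arg u) du / Z_K` on `U(1)` (`villainBondZ`, `villainDisorderDensity`) — the disorder law IS
  the interaction, which is the Nishimori-line condition — and the averaged quenched expectation
  `villainDisorderAvg` (Garban–Spencer Def. 2 with `ρ_u` replaced by the Villain law);
* `villainMean K = e^{−1/(2K)}`, the first trigonometric moment `𝔼[u]` of that law (proved to be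
  the moment in `VillainBondMoments`), and Garban–Spencer's estimator (2.9) in the Villain
  normalisation, `villainEstimator`;
* `BondSystem.Embedding` (a map of bond systems injective on bonds, bonds mapped up to
  orientation) and the push-forward `BondSystem.UnitChain.map` of unit chains along it, which
  transports the ball-path ensembles of `ℤ^d` (built on `latticeBonds Λ`) to any bond system
  containing a copy of `Λ` (e.g. a discrete torus).

Only definitions and their elementary API (positivity, continuity, normalisation, gauge
covariance `w(u·Y(φ,1), θ) = w(u, θφ)`) are here; the gauge identity, the moments, the
Messager–Miracle-Solé–Pfister inequality, the path estimator bound and the long-range-order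
theorem for the Villain interaction are proved in the sibling files `VillainNishimoriGauge`,
`VillainBondMoments`, `VillainMMPInequality`, `VillainPathEstimator`, `VillainLongRangeOrder`.

## Design

* Everything mirrors the XY files definition by definition (same `BondSystem`, `bondVar`,
  `torusHaar`, `cosDiff`, `UnitChain`), with `exp (β Re ·)` replaced by `v_K ∘ arg`; the circle is
  measurable through the tree's global instances `Circle.instMeasurableSpace/instBorelSpace`
  (`GrassmannIntegral.lean`, imported via `VillainMonotonicityProofs`).
* One stiffness `K > 0` for all bonds (the homogeneous model); bondwise stiffnesses are reached by
  the tree's Ginibre monotonicity (`AizenmanHarelPeledShapiro2021_villainTwoPoint_mono_holds`).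
* Mathlib / tree search: no Villain-with-phases model existed; `villainTwoPoint`
  (`VillainMonotonicity.lean`, angle-cube form, no phases) is identified with
  `villainExpect … 1 (cosDiff x y)` in `VillainLongRangeOrder`.

## References

* C. Garban, T. Spencer, J. Math. Phys. 63 (2022) 093302, arXiv:2109.01617: Def. 1–2, (1.3)–(1.4),
  (2.9), Remark 10. [GarbanSpencer2022]
* M. Aizenman, M. Harel, R. Peled, J. Shapiro, arXiv:2110.09498, §3.1 (the Villain substitution).
  [AizenmanHarelPeledShapiro2021]
-/

noncomputable section

open MeasureTheory Finset TopologicalSpace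
open scoped BigOperators ComplexConjugate

namespace Literature.Probability.LatticeModels

open Literature.MathematicalPhysics.QuantumFieldTheory

/-! ### The single-bond Villain law on `U(1)` -/

/-- The normalisation `Z_K = ∫ v_K(arg z) dz` of the single-bond Villain law on `U(1)` (Haar
probability `dz`; `= (2πK)^{-1/2}`, see `VillainBondMoments`).
[cite: GarbanSpencer2022, Definition 1 with Remark 10] -/
def villainBondZ (K : ℝ) : ℝ :=
  ∫ z, villainKernel K (Complex.arg (z : ℂ)) ∂Measure.haarMeasure (⊤ : PositiveCompacts Circle)

/-- `Z_K > 0` for `K > 0`. [folklore] -/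
theorem villainBondZ_pos {K : ℝ} (hK : 0 < K) : 0 < villainBondZ K := by
  unfold villainBondZ
  exact (continuous_villainKernel_arg hK).integral_pos_of_hasCompactSupport_nonneg_nonzero
    (HasCompactSupport.of_compactSpace _) (fun z => (villainKernel_pos hK _).le)
    (villainKernel_pos hK _).ne' (x := 1)

/-- The first trigonometric moment `λ_K = 𝔼[u] = e^{−1/(2K)}` of the single-bond Villain law
(the Villain analogue of Garban–Spencer's `λ(β) = I₁(β)/I₀(β)`, (2.5)); that it IS the moment is
`villainBond_moment_one` in `VillainBondMoments`. [cite: GarbanSpencer2022, (2.5) with Remark 10] -/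
def villainMean (K : ℝ) : ℝ := Real.exp (-(1 / (2 * K)))

/-- `0 < λ_K`. [folklore] -/
theorem villainMean_pos (K : ℝ) : 0 < villainMean K := Real.exp_pos _

/-- `λ_K ≤ 1` for `K > 0`. [folklore] -/
theorem villainMean_le_one {K : ℝ} (hK : 0 < K) : villainMean K ≤ 1 := by
  rw [villainMean, Real.exp_le_one_iff, neg_nonpos]
  positivity

section Disorder

variable {ι : Type*} [Fintype ι]

/-- The density (w.r.t. the Haar probability of `U(1)^ι`) of the **Nishimori disorder of the
Villain model**: independent bond phases with law `v_K(arg u) du / Z_K`,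
`∏_a v_K(arg u_a) / Z_K`. [cite: GarbanSpencer2022, Definitions 1 and 2 with Remark 10] -/
def villainDisorderDensity (K : ℝ) (u : ι → Circle) : ℝ :=
  ∏ a, villainKernel K (Complex.arg (u a : ℂ)) / villainBondZ K

/-- The Villain disorder density is positive (`K > 0`). [folklore] -/
theorem villainDisorderDensity_pos {K : ℝ} (hK : 0 < K) (u : ι → Circle) :
    0 < villainDisorderDensity K u :=
  Finset.prod_pos fun _ _ => div_pos (villainKernel_pos hK _) (villainBondZ_pos hK)

/-- The Villain disorder density is continuous (`K > 0`). [folklore] -/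
theorem continuous_villainDisorderDensity {K : ℝ} (hK : 0 < K) :
    Continuous (villainDisorderDensity (ι := ι) K) :=
  continuous_finsetProd _ fun a _ =>
    ((continuous_villainKernel_arg hK).comp (continuous_apply a)).div_const _

/-- The Villain disorder density has total mass one (`K > 0`). [folklore] -/
theorem integral_villainDisorderDensity {K : ℝ} (hK : 0 < K) :
    ∫ u, villainDisorderDensity K u ∂torusHaar ι = 1 := by
  unfold villainDisorderDensity torusHaar
  rw [integral_fintype_prod_eq_prod (𝕜 := ℝ)
    (fun (_ : ι) (z : Circle) => villainKernel K (Complex.arg (z : ℂ)) / villainBondZ K)]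
  refine Finset.prod_eq_one fun a _ => ?_
  rw [integral_div]
  exact div_self (villainBondZ_pos hK).ne'

/-- The **averaged quenched expectation** of a disorder functional `Φ` under the Villain
Nishimori disorder, `𝔼_K[Φ] = ∫ Φ(u) ∏_a (v_K(arg u_a)/Z_K) du`.
[cite: GarbanSpencer2022, Definition 2 with Remark 10] -/
def villainDisorderAvg {E : Type*} [NormedAddCommGroup E] [NormedSpace ℝ E] (K : ℝ)
    (Φ : (ι → Circle) → E) : E :=
  ∫ u, villainDisorderDensity K u • Φ u ∂torusHaar ι

end Disorder

namespace BondSystem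

variable {V ι : Type*} [Fintype ι] (G : BondSystem V ι)

/-! ### The Villain weight with bond phases -/

/-- The **Villain Gibbs weight with quenched bond phases** `u`:
`∏_a v_K(arg Y_a(θ, u))`, `Y_a(θ,u) = u_a θ̄_{src a} θ_{tgt a}` — Garban–Spencer's (1.3) with the
Villain substitution `e^{β cos} ⟹ v_K` (for `u ≡ 1` the Villain model of AHPS 2021 §3.1 on the
graph of `G`). [cite: GarbanSpencer2022, (1.3) with Remark 10] -/
def villainWeight (K : ℝ) (u : ι → Circle) (θ : V → Circle) : ℝ :=
  ∏ a, villainKernel K (Complex.arg ((G.bondVar u θ a : Circle) : ℂ))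

/-- The Villain weight is positive (`K > 0`). [folklore] -/
theorem villainWeight_pos {K : ℝ} (hK : 0 < K) (u : ι → Circle) (θ : V → Circle) :
    0 < G.villainWeight K u θ :=
  Finset.prod_pos fun _ _ => villainKernel_pos hK _

/-- The Villain weight is jointly continuous in `(u, θ)` (`K > 0`). [folklore] -/
theorem continuous_villainWeight_uncurry {K : ℝ} (hK : 0 < K) :
    Continuous fun p : (ι → Circle) × (V → Circle) => G.villainWeight K p.1 p.2 :=
  continuous_finsetProd _ fun a _ =>
    (continuous_villainKernel_arg hK).comp (G.continuous_bondVar_uncurry a)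

/-- The Villain weight is continuous in the spins (`K > 0`). [folklore] -/
theorem continuous_villainWeight {K : ℝ} (hK : 0 < K) (u : ι → Circle) :
    Continuous (G.villainWeight K u) := by
  unfold villainWeight
  exact continuous_finsetProd _ fun a _ =>
    (continuous_villainKernel_arg hK).comp (G.continuous_bondVar u a)

/-- Gauge covariance of the Villain weight: `w(u · Y(φ,1), θ) = w(u, θφ)`.
[cite: GarbanSpencer2022, proof of Lemma 2.1, (2.2)] -/
theorem villainWeight_mul_bondVar_one (K : ℝ) (u : ι → Circle) (φ θ : V → Circle) :
    G.villainWeight K (u * G.bondVar 1 φ) θ = G.villainWeight K u (θ * φ) := by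
  simp [villainWeight, bondVar_mul_bondVar_one]

/-- The Villain weight written over the phases: `w(u, θ) = ∏_a v_K(arg (u_a χ_a(θ)))`.
[folklore] -/
theorem villainWeight_eq_prod_bondChar (K : ℝ) (u : ι → Circle) (θ : V → Circle) :
    G.villainWeight K u θ = ∏ a, villainKernel K (Complex.arg ((u a * G.bondChar a θ : Circle) : ℂ)) := by
  simp only [villainWeight, bondVar_eq_mul_bondChar]

/-! ### Partition function and Gibbs expectations -/

variable [Fintype V]

/-- The Villain partition function with bond phases, `Z_{u,K} = ∫ ∏_a v_K(arg Y_a(θ,u)) dθ`.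
[cite: GarbanSpencer2022, (1.4) with Remark 10] -/
def villainPartitionFn (K : ℝ) (u : ι → Circle) : ℝ :=
  ∫ θ, G.villainWeight K u θ ∂torusHaar V

/-- The (real) Villain Gibbs expectation with bond phases, `⟨f⟩_{u,K} = Z⁻¹ ∫ f w_u dθ`.
[cite: GarbanSpencer2022, (1.4) with Remark 10] -/
def villainExpect (K : ℝ) (u : ι → Circle) (f : (V → Circle) → ℝ) : ℝ :=
  (∫ θ, f θ * G.villainWeight K u θ ∂torusHaar V) / G.villainPartitionFn K u

/-- The complex Villain Gibbs expectation with bond phases. [cite: GarbanSpencer2022, (1.4) and (2.8) with Remark 10] -/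
def villainCExpect (K : ℝ) (u : ι → Circle) (F : (V → Circle) → ℂ) : ℂ :=
  (∫ θ, F θ * G.villainWeight K u θ ∂torusHaar V) / G.villainPartitionFn K u

/-- The Villain weight is integrable (`K > 0`). [folklore] -/
theorem integrable_villainWeight {K : ℝ} (hK : 0 < K) (u : ι → Circle) :
    Integrable (G.villainWeight K u) (torusHaar V) :=
  integrable_torusHaar_of_continuous (G.continuous_villainWeight hK u)

/-- The Villain partition function is positive (`K > 0`). [folklore] -/
theorem villainPartitionFn_pos {K : ℝ} (hK : 0 < K) (u : ι → Circle) :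
    0 < G.villainPartitionFn K u :=
  (G.continuous_villainWeight hK u).integral_pos_of_hasCompactSupport_nonneg_nonzero
    (HasCompactSupport.of_compactSpace _) (fun θ => (G.villainWeight_pos hK u θ).le)
    (G.villainWeight_pos hK u 1).ne'

/-- Gauge invariance of the partition function: `Z_{u · Y(φ,1)} = Z_u`.
[cite: GarbanSpencer2022, proof of Lemma 2.1, (2.2)–(2.3)] -/
theorem villainPartitionFn_mul_bondVar_one (K : ℝ) (u : ι → Circle) (φ : V → Circle) :
    G.villainPartitionFn K (u * G.bondVar 1 φ) = G.villainPartitionFn K u := by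
  simp only [villainPartitionFn, villainWeight_mul_bondVar_one]
  exact integral_torusHaar_mul_right (G.villainWeight K u) φ

/-- `⟨1⟩ = 1` (`K > 0`). [folklore] -/
@[simp] theorem villainExpect_one {K : ℝ} (hK : 0 < K) (u : ι → Circle) :
    G.villainExpect K u (fun _ => 1) = 1 := by
  simp only [villainExpect, one_mul]
  exact div_self (G.villainPartitionFn_pos hK u).ne'

/-- A real observable's complex expectation is its real expectation. [folklore] -/
theorem villainCExpect_ofReal (K : ℝ) (u : ι → Circle) (f : (V → Circle) → ℝ) :
    G.villainCExpect K u (fun θ => (f θ : ℂ)) = (G.villainExpect K u f : ℂ) := by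
  simp only [villainCExpect, villainExpect, ← Complex.ofReal_mul, Complex.ofReal_div]
  rw [integral_complex_ofReal]

/-- The real part of a complex expectation is the expectation of the real part (continuous
observable, `K > 0`). [folklore] -/
theorem re_villainCExpect {K : ℝ} (hK : 0 < K) (u : ι → Circle) {F : (V → Circle) → ℂ}
    (hF : Continuous F) :
    (G.villainCExpect K u F).re = G.villainExpect K u (fun θ => (F θ).re) := by
  have hi : Integrable (fun θ => F θ * G.villainWeight K u θ) (torusHaar V) :=
    integrable_torusHaar_of_continuous
      (hF.mul (Complex.continuous_ofReal.comp (G.continuous_villainWeight hK u)))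
  have h2 := integral_re hi
  simp only [RCLike.re_to_complex] at h2
  rw [villainCExpect, villainExpect, Complex.div_ofReal_re, ← h2]
  congr 1
  refine integral_congr_ae (ae_of_all _ fun θ => ?_)
  simp [Complex.mul_re]

/-- `|⟨F⟩| ≤ sup |F|` (`K > 0`). [folklore] -/
theorem norm_villainCExpect_le {K : ℝ} (hK : 0 < K) (u : ι → Circle) (F : (V → Circle) → ℂ)
    {C : ℝ} (hC : ∀ θ, ‖F θ‖ ≤ C) : ‖G.villainCExpect K u F‖ ≤ C := by
  have hZ := G.villainPartitionFn_pos hK u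
  have hC0 : 0 ≤ C := (norm_nonneg _).trans (hC 1)
  rw [villainCExpect, norm_div, Complex.norm_real, Real.norm_of_nonneg hZ.le, div_le_iff₀ hZ]
  calc ‖∫ θ, F θ * G.villainWeight K u θ ∂torusHaar V‖
      ≤ ∫ θ, ‖F θ * (G.villainWeight K u θ : ℂ)‖ ∂torusHaar V := norm_integral_le_integral_norm _
    _ ≤ ∫ θ, C * G.villainWeight K u θ ∂torusHaar V := by
        refine integral_mono_of_nonneg (ae_of_all _ fun _ => norm_nonneg _)
          ((G.integrable_villainWeight hK u).const_mul C) (ae_of_all _ fun θ => ?_)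
        show ‖F θ * (G.villainWeight K u θ : ℂ)‖ ≤ C * G.villainWeight K u θ
        rw [norm_mul, Complex.norm_real, Real.norm_of_nonneg (G.villainWeight_pos hK u θ).le]
        exact mul_le_mul_of_nonneg_right (hC θ) (G.villainWeight_pos hK u θ).le
    _ = C * G.villainPartitionFn K u := by rw [integral_const_mul]; rfl

/-- `|⟨f⟩| ≤ sup |f|` for a real observable (`K > 0`). [folklore] -/
theorem abs_villainExpect_le {K : ℝ} (hK : 0 < K) (u : ι → Circle) (f : (V → Circle) → ℝ)
    {C : ℝ} (hC : ∀ θ, |f θ| ≤ C) : |G.villainExpect K u f| ≤ C := by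
  have h := G.norm_villainCExpect_le hK u (fun θ => (f θ : ℂ))
    (fun θ => by rw [Complex.norm_real, Real.norm_eq_abs]; exact hC θ)
  rwa [villainCExpect_ofReal, Complex.norm_real, Real.norm_eq_abs] at h

/-- Gauge covariance of expectations: `⟨F⟩_{u · Y(φ,1)} = ⟨F(· φ⁻¹)⟩_u`.
[cite: GarbanSpencer2022, proof of Lemma 2.1, (2.2)–(2.3)] -/
theorem villainCExpect_mul_bondVar_one (K : ℝ) (u : ι → Circle) (φ : V → Circle)
    (F : (V → Circle) → ℂ) :
    G.villainCExpect K (u * G.bondVar 1 φ) F = G.villainCExpect K u (fun θ => F (θ * φ⁻¹)) := by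
  rw [villainCExpect, villainCExpect, villainPartitionFn_mul_bondVar_one]
  congr 1
  simp only [villainWeight_mul_bondVar_one]
  have h := integral_torusHaar_mul_right (fun θ => F (θ * φ⁻¹) * (G.villainWeight K u θ : ℂ)) φ
  simpa only [mul_inv_cancel_right] using h

/-- A `u`-dependent constant factor leaves the quenched expectation: `⟨F · c⟩_u = ⟨F⟩_u · c`.
[folklore] -/
theorem villainCExpect_mul_const (K : ℝ) (u : ι → Circle) (F : (V → Circle) → ℂ) (c : ℂ) :
    G.villainCExpect K u (fun θ => F θ * c) = G.villainCExpect K u F * c := by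
  simp only [villainCExpect]
  rw [div_mul_eq_mul_div, ← integral_mul_const]
  congr 1
  refine integral_congr_ae (ae_of_all _ fun θ => ?_)
  ring

/-- The partition function is continuous in the phases (`K > 0`). [folklore] -/
theorem continuous_villainPartitionFn {K : ℝ} (hK : 0 < K) : Continuous (G.villainPartitionFn K) :=
  continuous_integral_torusHaar (G.continuous_villainWeight_uncurry hK)

/-- The quenched expectation of a jointly continuous observable is continuous in the phases
(`K > 0`). [folklore] -/
theorem continuous_villainCExpect {K : ℝ} (hK : 0 < K) {F : (ι → Circle) → (V → Circle) → ℂ}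
    (hF : Continuous (Function.uncurry F)) : Continuous fun u => G.villainCExpect K u (F u) := by
  have h1 : Continuous fun u => ∫ θ, F u θ * (G.villainWeight K u θ : ℂ) ∂torusHaar V :=
    continuous_integral_torusHaar (g := fun u θ => F u θ * (G.villainWeight K u θ : ℂ))
      (hF.mul (Complex.continuous_ofReal.comp (G.continuous_villainWeight_uncurry hK)))
  have h2 : Continuous fun u => (G.villainPartitionFn K u : ℂ) :=
    Complex.continuous_ofReal.comp (G.continuous_villainPartitionFn hK)
  exact h1.div h2 fun u => by exact_mod_cast (G.villainPartitionFn_pos hK u).ne'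

/-! ### The estimator (2.9) in the Villain normalisation -/

/-- **Garban–Spencer's estimator (2.9) for the Villain interaction**:
`R(u) = ∑_s w_s λ_K^{-|T_s|₁} U_{T_s}(u)` with `λ_K = e^{−1/(2K)}`.
[cite: GarbanSpencer2022, (2.9) with Remark 10] -/
def villainEstimator {x y : V} {S : Type*} [Fintype S] (K : ℝ) (w : S → ℝ)
    (T : S → G.UnitChain x y) (u : ι → Circle) : ℂ :=
  ∑ s, (w s * (villainMean K)⁻¹ ^ (T s).length : ℝ) * (T s).holonomy u

end BondSystem

/-! ### Embeddings of bond systems and the push-forward of unit chains -/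

namespace BondSystem

variable {V V' ι ι' : Type*} (G : BondSystem V ι) (G' : BondSystem V' ι')

/-- An **embedding of bond systems** `G → G'`: a vertex map, an injective bond map and
orientation signs `σ_a = ±1`, such that the bond `a : src a → tgt a` is mapped onto the bond
`emap a` of `G'` traversed with orientation `σ_a`, expressed through the bond characters:
`χ'_{emap a}(θ')^{σ_a} = χ_a(θ' ∘ vmap)`.  (E.g. the inclusion of the free-boundary bond system of
`Λ ⊂ ℤ^d` into the bond system of a discrete torus containing a copy of `Λ`.) [folklore] -/
structure Embedding where
  /-- the vertex map -/
  vmap : V → V'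
  /-- the bond map -/
  emap : ι → ι'
  /-- the orientation sign of a bond -/
  sign : ι → ℤ
  /-- the bond map is injective -/
  emap_injective : Function.Injective emap
  /-- the signs are `±1` -/
  sign_eq : ∀ a, sign a = 1 ∨ sign a = -1
  /-- the bond characters correspond, up to orientation -/
  bondChar_emap : ∀ (a : ι) (θ' : V' → Circle),
    ((G'.bondChar (emap a) θ' : Circle) : ℂ) ^ sign a = ((G.bondChar a (θ' ∘ vmap) : Circle) : ℂ)

variable {G G'}

namespace Embedding

/-- `|σ_a| = 1`. [folklore] -/
theorem natAbs_sign (e : G.Embedding G') (a : ι) : (e.sign a).natAbs = 1 := by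
  rcases e.sign_eq a with h | h <;> simp [h]

/-- `σ_a ≠ 0`. [folklore] -/
theorem sign_ne_zero (e : G.Embedding G') (a : ι) : e.sign a ≠ 0 := by
  rcases e.sign_eq a with h | h <;> simp [h]

variable [Fintype ι]

open Classical in
/-- The push-forward coefficient of a chain `T` on the bond `a'` of `G'`: `σ_a T_a` if
`a' = emap a`, and `0` off the image of `emap`. [folklore] -/
def pushCoeff (e : G.Embedding G') (T : ι → ℤ) (a' : ι') : ℤ :=
  ∑ a, if e.emap a = a' then e.sign a * T a else 0

/-- On the image: `pushCoeff (emap a) = σ_a T_a`. [folklore] -/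
theorem pushCoeff_emap (e : G.Embedding G') (T : ι → ℤ) (a : ι) :
    e.pushCoeff T (e.emap a) = e.sign a * T a := by
  unfold pushCoeff
  rw [Finset.sum_eq_single a]
  · rw [if_pos rfl]
  · intro b _ hba
    rw [if_neg fun h => hba (e.emap_injective h)]
  · intro h
    exact absurd (Finset.mem_univ a) h

/-- Off the image the push-forward coefficient vanishes. [folklore] -/
theorem pushCoeff_of_not_mem_range (e : G.Embedding G') (T : ι → ℤ) {a' : ι'}
    (h : a' ∉ Set.range e.emap) : e.pushCoeff T a' = 0 := by
  unfold pushCoeff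
  exact Finset.sum_eq_zero fun a _ => if_neg fun h' => h ⟨a, h'⟩

/-- On the image, `pushCoeff` vanishes iff the original coefficient does. [folklore] -/
theorem pushCoeff_emap_eq_zero_iff (e : G.Embedding G') (T : ι → ℤ) (a : ι) :
    e.pushCoeff T (e.emap a) = 0 ↔ T a = 0 := by
  rw [pushCoeff_emap, mul_eq_zero, or_iff_right (e.sign_ne_zero a)]

variable [Fintype ι']

/-- A product over the bonds of `G'` of a function supported on the image of `emap` is a
product over the bonds of `G`. [folklore] -/
theorem prod_eq_prod_emap (e : G.Embedding G') {M : Type*} [CommMonoid M] (f : ι' → M)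
    (hf : ∀ a', a' ∉ Set.range e.emap → f a' = 1) : ∏ a', f a' = ∏ a, f (e.emap a) := by
  classical
  calc ∏ a', f a' = ∏ a' ∈ (Finset.univ : Finset ι).image e.emap, f a' :=
        (Finset.prod_subset (Finset.subset_univ _) fun a' _ ha' => hf a' fun ⟨a, ha⟩ =>
          ha' (Finset.mem_image.2 ⟨a, Finset.mem_univ _, ha⟩)).symm
    _ = ∏ a, f (e.emap a) := Finset.prod_image fun a _ b _ h => e.emap_injective h

/-- A sum over the bonds of `G'` of a function supported on the image of `emap` is a sum over
the bonds of `G`. [folklore] -/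
theorem sum_eq_sum_emap (e : G.Embedding G') {M : Type*} [AddCommMonoid M] (f : ι' → M)
    (hf : ∀ a', a' ∉ Set.range e.emap → f a' = 0) : ∑ a', f a' = ∑ a, f (e.emap a) := by
  classical
  calc ∑ a', f a' = ∑ a' ∈ (Finset.univ : Finset ι).image e.emap, f a' :=
        (Finset.sum_subset (Finset.subset_univ _) fun a' _ ha' => hf a' fun ⟨a, ha⟩ =>
          ha' (Finset.mem_image.2 ⟨a, Finset.mem_univ _, ha⟩)).symm
    _ = ∑ a, f (e.emap a) := Finset.sum_image fun a _ b _ h => e.emap_injective h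

end Embedding

variable [Fintype ι] [Fintype ι']

/-- **Push-forward of a unit chain along an embedding of bond systems**: the chain
`emap a ↦ σ_a T_a`, `0` off the image, is a unit chain from `vmap x` to `vmap y`. [folklore] -/
def UnitChain.map {x y : V} (e : G.Embedding G') (T : G.UnitChain x y) :
    G'.UnitChain (e.vmap x) (e.vmap y) where
  coeff := e.pushCoeff T.coeff
  natAbs_le a' := by
    by_cases h : a' ∈ Set.range e.emap
    · obtain ⟨a, rfl⟩ := h
      rw [e.pushCoeff_emap, Int.natAbs_mul, e.natAbs_sign, one_mul]
      exact T.natAbs_le a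
    · rw [e.pushCoeff_of_not_mem_range _ h]
      exact zero_le_one
  boundary θ' := by
    have hb := T.boundary (θ' ∘ e.vmap)
    have hd : ((diffChar (e.vmap x) (e.vmap y) θ' : Circle) : ℂ) =
        ((diffChar x y (θ' ∘ e.vmap) : Circle) : ℂ) := rfl
    rw [hd, ← hb, e.prod_eq_prod_emap]
    · refine Finset.prod_congr rfl fun a _ => ?_
      rw [e.pushCoeff_emap, zpow_mul, e.bondChar_emap]
    · intro a' ha'
      rw [e.pushCoeff_of_not_mem_range _ ha', zpow_zero]

/-- The coefficients of the push-forward chain. [folklore] -/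
@[simp] theorem UnitChain.coeff_map {x y : V} (e : G.Embedding G') (T : G.UnitChain x y) :
    (T.map e).coeff = e.pushCoeff T.coeff := rfl

/-- The push-forward preserves the overlap of two chains. [folklore] -/
theorem UnitChain.overlap_map {x y : V} (e : G.Embedding G') (T T' : G.UnitChain x y) :
    (T.map e).overlap (T'.map e) = T.overlap T' := by
  classical
  unfold UnitChain.overlap
  have hset : (Finset.univ.filter fun a' => (T.map e).coeff a' ≠ 0 ∧ (T'.map e).coeff a' ≠ 0) =
      (Finset.univ.filter fun a => T.coeff a ≠ 0 ∧ T'.coeff a ≠ 0).image e.emap := by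
    ext a'
    simp only [Finset.mem_filter, Finset.mem_univ, true_and, Finset.mem_image, UnitChain.coeff_map]
    constructor
    · rintro ⟨h1, h2⟩
      by_cases h : a' ∈ Set.range e.emap
      · obtain ⟨a, rfl⟩ := h
        exact ⟨a, ⟨fun h0 => h1 ((e.pushCoeff_emap_eq_zero_iff T.coeff a).2 h0),
          fun h0 => h2 ((e.pushCoeff_emap_eq_zero_iff T'.coeff a).2 h0)⟩, rfl⟩
      · exact absurd (e.pushCoeff_of_not_mem_range T.coeff h) h1
    · rintro ⟨a, ⟨h1, h2⟩, rfl⟩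
      exact ⟨fun h0 => h1 ((e.pushCoeff_emap_eq_zero_iff T.coeff a).1 h0),
        fun h0 => h2 ((e.pushCoeff_emap_eq_zero_iff T'.coeff a).1 h0)⟩
  rw [hset, Finset.card_image_of_injective _ e.emap_injective]

/-- The push-forward preserves the length of a chain. [folklore] -/
theorem UnitChain.length_map {x y : V} (e : G.Embedding G') (T : G.UnitChain x y) :
    (T.map e).length = T.length := by
  unfold UnitChain.length
  rw [UnitChain.coeff_map, e.sum_eq_sum_emap]
  · refine Finset.sum_congr rfl fun a _ => ?_
    rw [e.pushCoeff_emap, Int.natAbs_mul, e.natAbs_sign, one_mul]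
  · intro a' ha'
    rw [e.pushCoeff_of_not_mem_range _ ha', Int.natAbs_zero]

end BondSystem

end Literature.Probability.LatticeModels
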